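import Literature.NumberTheory.Sieve.FordMaynardTypeISums
import HarnessLib

/-!
# Ford–Maynard's Type-I bound for `w_n = h(𝐯(n)) μ²(n)` at every divisor `m ≤ x^γ`

Sixth file of the arithmetic half of Theorem 6.3 (a) / Theorem 9.1 of K. Ford, J. Maynard,
*On the theory of prime producing sieves* (arXiv:2407.14368). Everything here is PROVED. We
assemble `FordMaynardSequence.lean` (the Type-I sum at `m` as `∑_s (1/s!) injSum_s`),
`FordMaynardTypeISums.lean` (bad tuples; comparison with integrals) and
`FordMaynardPrimeSumsSlices.lean` (the integrals cancel by (TypeI-f)) into the analogue of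
(construction-TypeI) of §6.2 with a log-power saving:

* `exists_Vsum_bound` — for `h ∈ 𝒮` bounded, supported on vectors with entries `≥ η`,
  piecewise Lipschitz in each dimension, vanishing in dimensions `> K_max`, satisfying (TypeI-f)
  with parameter `γ`, and vanishing at vectors with a proper subsum in `[γ − ε, γ + ε]`: for every
  `A` there are `C, X` with `|∑_{r ≤ R, x/2 < mr} w_{mr}| ≤ C x/(m (log x)^A)` for all `x ≥ X`,
  `1 ≤ m ≤ x^γ`, `R ≤ x/m`.

## References

* K. Ford, J. Maynard, *On the theory of prime producing sieves*, arXiv:2407.14368v1 (2024), §6.2,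
  proof of Theorem 6.3 (a), (construction-TypeI) and (Smcd). [FordMaynard2024PrimeSieves]
-/

noncomputable section

open MeasureTheory Finset Real

namespace Literature.NumberTheory.Sieve.FordMaynard

/-- Eventually in `x`: the elementary largeness conditions used in `exists_Vsum_bound`. [folklore] -/
theorem eventually_largeX₂ (η γ ε : ℝ) (hη : 0 < η) (hγ1 : γ < 1) (hε : 0 < ε) (A : ℕ) :
    ∃ X : ℝ, 2 ≤ X ∧ ∀ x : ℝ, X ≤ x →
      4 ≤ x ∧ 2 * Real.log 2 / Real.log x ≤ ε ∧ 2 ≤ x ^ (1 - γ) ∧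
        Real.log x ^ A * x ^ (-(η / 2)) ≤ 1 / 2 ∧ Real.log x ^ A * x ^ (γ - 1) ≤ 1 / 2 := by
  have h1 : ∀ᶠ x : ℝ in Filter.atTop, 4 ≤ x := Filter.eventually_ge_atTop 4
  have h2 : ∀ᶠ x : ℝ in Filter.atTop, 2 * Real.log 2 / Real.log x ≤ ε := by
    have ht : Filter.Tendsto (fun x : ℝ => 2 * Real.log 2 / Real.log x) Filter.atTop (nhds 0) :=
      Filter.Tendsto.const_div_atTop Real.tendsto_log_atTop _
    exact (ht.eventually (ge_mem_nhds hε)).mono fun x hx => hx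
  have h3 : ∀ᶠ x : ℝ in Filter.atTop, 2 ≤ x ^ (1 - γ) :=
    (tendsto_rpow_atTop (by linarith)).eventually_ge_atTop 2
  have hdecay : ∀ c : ℝ, 0 < c → ∀ᶠ x : ℝ in Filter.atTop, Real.log x ^ A * x ^ (-c) ≤ 1 / 2 := by
    intro c hc
    have hlo := isLittleO_log_rpow_rpow_atTop (A : ℝ) hc
    filter_upwards [hlo.bound (by norm_num : (0 : ℝ) < 1 / 2), Filter.eventually_ge_atTop (1 : ℝ)] with x hx hx1
    rw [Real.norm_eq_abs, Real.norm_eq_abs, Real.rpow_natCast, abs_of_nonneg (pow_nonneg (Real.log_nonneg hx1) _),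
      abs_of_nonneg (Real.rpow_nonneg (by linarith) _)] at hx
    have hx0 : 0 < x := by linarith
    rw [Real.rpow_neg hx0.le, ← div_eq_mul_inv, div_le_iff₀ (Real.rpow_pos_of_pos hx0 c)]
    linarith
  have h4 := hdecay (η / 2) (by positivity)
  have h5 : ∀ᶠ x : ℝ in Filter.atTop, Real.log x ^ A * x ^ (γ - 1) ≤ 1 / 2 := by
    have := hdecay (1 - γ) (by linarith)
    refine this.mono fun x hx => ?_
    rwa [show -(1 - γ) = γ - 1 by ring] at hx
  obtain ⟨X, hX⟩ := Filter.eventually_atTop.1 (h1.and (h2.and (h3.and (h4.and h5))))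
  exact ⟨max X 2, le_max_right _ _, fun x hx => hX x (le_trans (le_max_left _ _) hx)⟩

/-- The subsum of `normVec u y` over the `u`-coordinates is `λ/(λ + |y|)`. [folklore] -/
theorem sum_normVec_castAdd {t s : ℕ} (u : Fin t → ℝ) (y : Fin s → ℝ) :
    ∑ i ∈ (Finset.univ : Finset (Fin t)).map (Fin.castAddEmb s), normVec u y i =
      (∑ i, u i) / ((∑ i, u i) + ∑ i, y i) := by
  rw [Finset.sum_map]
  have key : ∀ i : Fin t, normVec u y (Fin.castAddEmb s i) = u i / ((∑ i, u i) + ∑ i, y i) := by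
    intro i
    show Fin.append u y (Fin.castAdd s i) / ((∑ j, u j) + ∑ j, y j) = _
    rw [Fin.append_left]
  rw [Finset.sum_congr rfl (fun i _ => key i), Finset.sum_div]

/-- **Type-I bound at every divisor** ((construction-TypeI) of §6.2 with a log-power saving). Let
`h ∈ 𝒮` be bounded by `H_b`, supported on vectors with entries `≥ η` (`0 < η ≤ 1`), piecewise
Lipschitz in each dimension, vanishing in dimensions `> K_max`, satisfying (TypeI-f) with parameter
`γ ∈ (0,1)`, and vanishing at every vector with a nonempty proper subsum in `[γ − ε, γ + ε]`. Then
for every `A` there are `C, X` such that `|∑_{r ≤ R, x/2 < mr} w_{mr}| ≤ C x / (m (log x)^A)` for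
all `x ≥ X`, `1 ≤ m ≤ x^γ` and `R ≤ x/m`. [cite: FordMaynard2024PrimeSieves, §6.2 (proof of Theorem 6.3 (a), (construction-TypeI))] -/
theorem exists_Vsum_bound {h : VecFn} (hsym : h.IsSymmetric) {η γ ε Hb : ℝ} (hη : 0 < η) (hη1 : η ≤ 1)
    (hγ0 : 0 < γ) (hγ1 : γ < 1) (hε : 0 < ε)
    (hsupp : ∀ (k : ℕ) (v : Fin k → ℝ), h k v ≠ 0 → ∀ i, η ≤ v i)
    (hbdd : ∀ (k : ℕ) (v : Fin k → ℝ), |h k v| ≤ Hb) (hpl : ∀ k, IsPiecewiseLipschitz (h k))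
    (htypeI : TypeIIdentity γ h) {Kmax : ℕ} (hvan : ∀ k, Kmax < k → ∀ v, h k v = 0)
    (hγv : ∀ (k : ℕ) (v : Fin k → ℝ) (B : Finset (Fin k)), B.Nonempty → B ≠ Finset.univ →
      γ - ε ≤ ∑ i ∈ B, v i → ∑ i ∈ B, v i ≤ γ + ε → h k v = 0)
    (A : ℕ) :
    ∃ C : ℝ, 0 ≤ C ∧ ∃ X : ℝ, 2 ≤ X ∧ ∀ x : ℝ, X ≤ x → ∀ m : ℕ, 1 ≤ m → (m : ℝ) ≤ x ^ γ →
      ∀ R : ℕ, (R : ℝ) ≤ x / m → |Vsum h x m R| ≤ C * x / (m * Real.log x ^ A) := by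
  classical
  have hHb : 0 ≤ Hb := (abs_nonneg _).trans (hbdd 0 fun i => i.elim0)
  have hmeas : ∀ k, Measurable (h k) := fun k => (hpl k).measurable
  have hη2 : 0 < η / 2 := by positivity
  have hη21 : η / 2 ≤ 1 := by linarith
  ------------------------------------------------------------------
  -- constants: `F2` data, corner data, piece data
  ------------------------------------------------------------------
  have hF2all := fun s => exists_primeTupleSum_approx (η / 2) hη2 hη21 A s
  choose CF hCF0 XF hXF2 hF2 using hF2all
  have hCall := fun d => exists_primeTupleSum_cornerInd_le (η / 2) hη2 hη21 d
  choose Cc hCc0 Xc hXc2 hCc using hCall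
  have hdata : ∀ k, ∃ (n : ℕ) (Pc : Fin n → Set (Fin k → ℝ)) (hp : Fin n → (Fin k → ℝ) → ℝ)
      (Kp Mp : Fin n → ℝ), (∀ j, 0 ≤ Kp j ∧ 0 ≤ Mp j) ∧
      (∀ j, Convex ℝ (Pc j) ∧ MeasurableSet (Pc j) ∧ Measurable (hp j) ∧ (∀ v, v ∉ Pc j → hp j v = 0) ∧
        (∀ v ∈ Pc j, ∀ w ∈ Pc j, |hp j v - hp j w| ≤ Kp j * ‖v - w‖) ∧ ∀ v, |hp j v| ≤ Mp j) ∧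
      ∀ v, h k v = ∑ j, hp j v := fun k => exists_pieces (hpl k)
  choose nk Pck hpk Kpk Mpk hKMk hpck hsumk using hdata
  set D : ℕ → ℝ := fun k => ∑ j, (Kpk k j * (8 * Kmax + 2) + Mpk k j) with hDdef
  have hD0 : ∀ k, 0 ≤ D k := fun k => Finset.sum_nonneg fun j _ => by
    obtain ⟨h1, h2⟩ := hKMk k j; positivity
  set Dmax : ℝ := ∑ k ∈ Finset.range (Kmax + 1), D k with hDmax
  have hDmax0 : 0 ≤ Dmax := Finset.sum_nonneg fun k _ => hD0 k
  have hDle : ∀ k, k ≤ Kmax → D k ≤ Dmax := fun k hk =>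
    Finset.single_le_sum (fun k _ => hD0 k) (Finset.mem_range.2 (Nat.lt_succ_of_le hk))
  -- the final constant
  set C : ℝ := ∑ s ∈ Finset.Icc 1 Kmax, (CF s * Dmax + Hb * s * (s + Kmax) * Cc (s - 1)) with hCdef
  have hC0 : 0 ≤ C := Finset.sum_nonneg fun s _ => by
    have h1 := hCF0 s; have h2 := hCc0 (s - 1); positivity
  -- the threshold
  obtain ⟨X₀, hX₀2, hX₀⟩ := eventually_largeX₂ η γ ε hη hγ1 hε A
  set X : ℝ := X₀ + ∑ s ∈ Finset.range (Kmax + 1), (max (XF s) 0 + max (Xc s) 0) with hXdef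
  have hXsum0 : 0 ≤ ∑ s ∈ Finset.range (Kmax + 1), (max (XF s) 0 + max (Xc s) 0) :=
    Finset.sum_nonneg fun s _ => by positivity
  have hXF : ∀ s, s ≤ Kmax → XF s ≤ X := by
    intro s hs
    have h1 : max (XF s) 0 + max (Xc s) 0 ≤ ∑ s ∈ Finset.range (Kmax + 1), (max (XF s) 0 + max (Xc s) 0) :=
      Finset.single_le_sum (f := fun s => max (XF s) 0 + max (Xc s) 0) (fun s _ => by positivity)
        (Finset.mem_range.2 (Nat.lt_succ_of_le hs))
    have : XF s ≤ max (XF s) 0 := le_max_left _ _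
    have : 0 ≤ max (Xc s) 0 := le_max_right _ _
    linarith
  have hXc : ∀ s, s ≤ Kmax → Xc s ≤ X := by
    intro s hs
    have h1 : max (XF s) 0 + max (Xc s) 0 ≤ ∑ s ∈ Finset.range (Kmax + 1), (max (XF s) 0 + max (Xc s) 0) :=
      Finset.single_le_sum (f := fun s => max (XF s) 0 + max (Xc s) 0) (fun s _ => by positivity)
        (Finset.mem_range.2 (Nat.lt_succ_of_le hs))
    have : Xc s ≤ max (Xc s) 0 := le_max_left _ _
    have : 0 ≤ max (XF s) 0 := le_max_right _ _
    linarith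
  refine ⟨C, hC0, X, by linarith, ?_⟩
  intro x hx m hm1 hmγ R hR
  obtain ⟨hx4, hlogε, hx1γ, hdec1, hdec2⟩ := hX₀ x (by linarith)
  have hx1 : 1 < x := by linarith
  have hx0 : 0 < x := by linarith
  have hL0 : 0 < Real.log x := Real.log_pos hx1
  set L := Real.log x with hL
  have hL1 : 1 ≤ L := by
    rw [hL, ← Real.log_exp 1]
    exact Real.log_le_log (Real.exp_pos 1) (by linarith [Real.exp_one_lt_d9])
  have hLA : 0 < L ^ A := pow_pos hL0 A
  have hLA1 : 1 ≤ L ^ A := one_le_pow₀ hL1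
  have hlog2L : Real.log 2 / L ≤ 1 / 2 := by
    rw [div_le_iff₀ hL0]
    have : Real.log 4 ≤ L := Real.log_le_log (by norm_num) hx4
    have h4 : Real.log 4 = 2 * Real.log 2 := by
      rw [show (4 : ℝ) = 2 ^ 2 by norm_num, Real.log_pow]; ring
    linarith
  have hmR : (0 : ℝ) < m := by exact_mod_cast hm1
  have hm0 : m ≠ 0 := by omega
  -- `m ≤ x/2`
  have hxγ : x ^ γ ≤ x / 2 := by
    have : x ^ γ * x ^ (1 - γ) = x := by
      rw [← Real.rpow_add hx0, add_sub_cancel, Real.rpow_one]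
    rw [le_div_iff₀ (by norm_num : (0 : ℝ) < 2)]
    calc x ^ γ * 2 ≤ x ^ γ * x ^ (1 - γ) := mul_le_mul_of_nonneg_left hx1γ (Real.rpow_nonneg hx0.le _)
      _ = x := this
  have hmx2 : (m : ℝ) ≤ x / 2 := hmγ.trans hxγ
  have hmx : (m : ℝ) ≤ x := hmx2.trans (by linarith)
  -- target shape
  have htarget : C * x / (m * L ^ A) = C * (x / m) / L ^ A := by
    field_simp
  rw [htarget]
  ------------------------------------------------------------------
  -- case (a): `m` not squarefree
  ------------------------------------------------------------------
  by_cases hmsq : Squarefree m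
  swap
  · have : Vsum h x m R = 0 := by
      unfold Vsum
      refine Finset.sum_eq_zero fun r _ => wseq_of_not_squarefree h fun hsq => hmsq ?_
      exact (Nat.squarefree_mul_iff.1 hsq).2.1
    rw [this, abs_zero]; positivity
  ------------------------------------------------------------------
  -- the identity `Vsum = ∑_s (1/s!) injSum_s`
  ------------------------------------------------------------------
  rw [Vsum_eq_sum_injSum hsym hvan hx1 hmsq hmx2 hR le_rfl]
  set t := m.primeFactors.card with ht
  set u := uvec x m with hu
  set lam : ℝ := Real.log m / L with hlam
  set c₀ : ℝ := Real.log (x / (2 * m)) / L with hc₀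
  set c₁ : ℝ := Real.log R / L with hc₁
  have hsumu : ∑ i, u i = lam := by rw [hu, hlam, sum_uvec x hmsq]
  have hlam0 : 0 ≤ lam := div_nonneg (Real.log_nonneg (by exact_mod_cast hm1)) hL0.le
  have hlamγ : lam ≤ γ := by
    rw [hlam, div_le_iff₀ hL0]
    calc Real.log m ≤ Real.log (x ^ γ) := Real.log_le_log hmR hmγ
      _ = γ * L := by rw [Real.log_rpow hx0]
  have hc₀eq : c₀ = 1 - Real.log 2 / L - lam := by
    rw [hc₀, hlam, Real.log_div hx0.ne' (by positivity), Real.log_mul (by norm_num) hmR.ne']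
    field_simp
    ring
  have hlc₀ : lam + c₀ = 1 - Real.log 2 / L := by rw [hc₀eq]; ring
  have hρ : 1 / 2 ≤ (∑ i, u i) + c₀ := by rw [hsumu, hlc₀]; linarith
  have hρ0 : 0 < (∑ i, u i) + c₀ := by linarith
  have hc₁le : c₁ ≤ 1 - lam := by
    -- `R ≤ x/m`
    rw [hc₁, hlam, le_sub_iff_add_le, ← add_div, div_le_one hL0]
    rcases Nat.eq_zero_or_pos R with hR0 | hR0
    · rw [hR0, Nat.cast_zero, Real.log_zero, zero_add]
      exact Real.log_le_log hmR hmx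
    · rw [← Real.log_mul (by exact_mod_cast hR0.ne') hmR.ne']
      refine Real.log_le_log (by positivity) ?_
      rw [← le_div_iff₀ hmR]; exact hR
  have hc₁1 : c₁ ≤ 1 := by linarith
  have hxc₁ : x ^ c₁ ≤ x / m := by
    calc x ^ c₁ ≤ x ^ (1 - lam) := Real.rpow_le_rpow_of_exponent_le hx1.le hc₁le
      _ = x / m := by
          rw [Real.rpow_sub hx0, Real.rpow_one, hlam, Real.rpow_def_of_pos hx0,
            mul_div_cancel₀ _ hL0.ne', Real.exp_log hmR]
  have huabs : ∀ i, |u i| ≤ 1 := by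
    intro i
    have h0 := uvec_nonneg hx1 m i
    rw [← hu] at h0
    rw [abs_of_nonneg h0]
    have : u i ≤ ∑ j, u j := apply_le_sum_of_nonneg (fun j => by rw [hu]; exact uvec_nonneg hx1 m j) i
    linarith
  ------------------------------------------------------------------
  -- case (b): `λ > γ (1 − log 2/L)`: every term vanishes (proper subsum near `γ`)
  ------------------------------------------------------------------
  by_cases hcase : γ * (1 - Real.log 2 / L) < lam
  · -- auxiliary inequalities
    have hl0 : 0 ≤ Real.log 2 / L := div_nonneg (Real.log_nonneg one_le_two) hL0.le
    have hγl : γ * (Real.log 2 / L) ≤ 1 * (Real.log 2 / L) := mul_le_mul_of_nonneg_right hγ1.le hl0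
    have hl2 : 2 * (Real.log 2 / L) ≤ ε := by rw [← mul_div_assoc]; exact hlogε
    have hγε : γ - ε ≤ lam := by
      have h1 : γ * (1 - Real.log 2 / L) = γ - γ * (Real.log 2 / L) := by ring
      linarith only [h1, hcase, hγl, hl2, hl0]
    have hup : γ ≤ (γ + ε) * (1 - Real.log 2 / L) := by
      have h1 : (γ + ε) * (1 - Real.log 2 / L) = γ + ε - γ * (Real.log 2 / L) - ε * (Real.log 2 / L) := by
        ring
      have h3 : ε * (Real.log 2 / L) ≤ ε * (1 / 2) := mul_le_mul_of_nonneg_left hlog2L hε.le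
      linarith only [h1, h3, hγl, hl2, hl0]
    have hzero : ∀ s ∈ Finset.Icc 1 Kmax, injSum h x m R s = 0 := by
      intro s hs
      rw [Finset.mem_Icc] at hs
      unfold injSum
      refine Finset.sum_eq_zero fun q _ => ?_
      show mainG h t s u c₀ c₁ (logVec x q) = 0
      unfold mainG
      split_ifs with hc
      · -- the subsum over the `u`-coordinates lies in `[γ − ε, γ + ε]`
        have ht1 : 1 ≤ t := by
          rw [ht, Nat.one_le_iff_ne_zero]
          intro h0
          rw [Finset.card_eq_zero, Nat.primeFactors_eq_empty] at h0
          rcases h0 with h0 | h0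
          · exact hm0 h0
          · have : lam = 0 := by rw [hlam, h0, Nat.cast_one, Real.log_one, zero_div]
            have : 0 ≤ γ * (1 - Real.log 2 / L) := mul_nonneg hγ0.le (by linarith)
            linarith
        set B : Finset (Fin (t + s)) := (Finset.univ : Finset (Fin t)).map (Fin.castAddEmb s) with hB
        have hBne : B.Nonempty := by
          rw [hB, Finset.map_nonempty]; exact ⟨⟨0, ht1⟩, Finset.mem_univ _⟩
        have hBuniv : B ≠ Finset.univ := by
          intro hBu
          have : Fin.natAdd t (⟨0, hs.1⟩ : Fin s) ∈ B := by rw [hBu]; exact Finset.mem_univ _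
          rw [hB, Finset.mem_map] at this
          obtain ⟨i, -, hi⟩ := this
          have := congrArg Fin.val hi
          simp [Fin.castAddEmb] at this
          omega
        set Sy := ∑ i, logVec x q i with hSy
        have hsub : ∑ i ∈ B, normVec u (logVec x q) i = lam / (lam + Sy) := by
          rw [hB, sum_normVec_castAdd, hsumu]
        have hden : 1 / 2 ≤ lam + Sy := by rw [← hsumu]; linarith [hc.1]
        have hden0 : 0 < lam + Sy := by linarith
        have hSy1 : lam + Sy ≤ 1 := by linarith [hc.2, hc₁le]
        refine hγv _ _ B hBne hBuniv ?_ ?_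
        · rw [hsub, le_div_iff₀ hden0]
          rcases le_or_gt 0 (γ - ε) with hs0 | hs0
          · calc (γ - ε) * (lam + Sy) ≤ (γ - ε) * 1 := mul_le_mul_of_nonneg_left hSy1 hs0
              _ ≤ lam := by linarith
          · have : (γ - ε) * (lam + Sy) ≤ 0 := mul_nonpos_of_nonpos_of_nonneg hs0.le hden0.le
            linarith
        · rw [hsub, div_le_iff₀ hden0]
          have h1 : 1 - Real.log 2 / L < lam + Sy := by rw [← hlc₀, ← hsumu]; linarith [hc.1]
          have hγε0 : 0 ≤ γ + ε := by linarith
          calc lam ≤ γ := hlamγ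
            _ ≤ (γ + ε) * (1 - Real.log 2 / L) := hup
            _ ≤ (γ + ε) * (lam + Sy) := mul_le_mul_of_nonneg_left h1.le hγε0
      · rfl
    rw [Finset.sum_eq_zero (fun s hs => by rw [hzero s hs, mul_zero]), abs_zero]
    exact div_nonneg (mul_nonneg hC0 (div_nonneg hx0.le hmR.le)) hLA.le
  ------------------------------------------------------------------
  -- case (c): `λ ≤ γ (1 − log 2/L)`: analytic estimates
  ------------------------------------------------------------------
  have hcase' : lam ≤ γ * (1 - Real.log 2 / L) := not_lt.1 hcase
  have hγw : ∀ w, c₀ < w → w ≤ c₁ → (∑ i, u i) ≤ γ * ((∑ i, u i) + w) := by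
    intro w hw _
    rw [hsumu]
    have : 1 - Real.log 2 / L < lam + w := by rw [← hlc₀]; linarith
    calc lam ≤ γ * (1 - Real.log 2 / L) := hcase'
      _ ≤ γ * (lam + w) := mul_le_mul_of_nonneg_left this.le hγ0.le
  -- the main terms cancel
  have hmain := sum_primeTupleIntegral_mainG_eq_zero hη hsupp hbdd hmeas htypeI hvan hx1 u hc₁1 hρ0 hγw
    (S := Kmax) (t := t) (Nat.le_add_left _ _)
  -- per-`s` estimates
  have hper : ∀ s ∈ Finset.Icc 1 Kmax,
      |(1 / (s.factorial : ℝ)) * injSum h x m R s -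
        (1 / (s.factorial : ℝ)) * primeTupleIntegral s x (mainG h t s u c₀ c₁)| ≤
        (CF s * Dmax + Hb * s * (s + Kmax) * Cc (s - 1)) * (x / m) / L ^ A := by
    intro s hs
    rw [Finset.mem_Icc] at hs
    obtain ⟨d, rfl⟩ : ∃ d, s = d + 1 := ⟨s - 1, by omega⟩
    have hfact : (1 : ℝ) / ((d + 1).factorial : ℝ) ≤ 1 := by
      rw [div_le_one (by positivity)]; exact_mod_cast Nat.one_le_iff_ne_zero.2 (Nat.factorial_ne_zero _)
    have hfact0 : (0 : ℝ) ≤ 1 / ((d + 1).factorial : ℝ) := by positivity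
    -- (E4): bad tuples
    have hE4 := abs_primeTupleSum_sub_injSum_le hsym hη hsupp hbdd (x := x) (m := m) R hρ rfl d
    have hcorner : primeTupleSum d x (cornerInd d (η / 2) (c₁ - η / 2)) ≤ Cc d * (x ^ (c₁ - η / 2) + 1) :=
      hCc d x (le_trans (hXc d (by omega)) hx) _ (by linarith only [hc₁1, hη])
    have hbad : |primeTupleSum (d + 1) x (mainG h t (d + 1) u c₀ c₁) - injSum h x m R (d + 1)| ≤
        Hb * (d + 1) * (d + 1 + Kmax) * (Cc d * ((x / m) / L ^ A)) := by
      -- `x^{c₁ − η/2} + 1 ≤ (x/m)/L^A`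
      have hxdec : x ^ (c₁ - η / 2) + 1 ≤ (x / m) / L ^ A := by
        have h1 : x ^ (c₁ - η / 2) = x ^ c₁ * x ^ (-(η / 2)) := by
          rw [← Real.rpow_add hx0]; ring_nf
        have h2 : (1 : ℝ) ≤ (x / m) * x ^ (γ - 1) := by
          have : x ^ (γ - 1) = x ^ γ / x := by rw [Real.rpow_sub hx0, Real.rpow_one]
          rw [this, div_mul_div_comm, mul_comm x, ← div_mul_div_comm, div_self hx0.ne', mul_one,
            one_le_div hmR]
          exact hmγ
        rw [le_div_iff₀ hLA, h1]
        have h3 : x ^ c₁ * x ^ (-(η / 2)) * L ^ A ≤ (x / m) * (1 / 2) := by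
          calc x ^ c₁ * x ^ (-(η / 2)) * L ^ A = x ^ c₁ * (L ^ A * x ^ (-(η / 2))) := by ring
            _ ≤ (x / m) * (1 / 2) := mul_le_mul hxc₁ hdec1 (mul_nonneg hLA.le (Real.rpow_nonneg hx0.le _))
                (div_nonneg hx0.le hmR.le)
        have h4 : 1 * L ^ A ≤ (x / m) * (1 / 2) := by
          calc 1 * L ^ A ≤ (x / m) * x ^ (γ - 1) * L ^ A := mul_le_mul_of_nonneg_right h2 hLA.le
            _ = (x / m) * (L ^ A * x ^ (γ - 1)) := by ring
            _ ≤ (x / m) * (1 / 2) := mul_le_mul_of_nonneg_left hdec2 (div_nonneg hx0.le hmR.le)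
        have hid : (x ^ c₁ * x ^ (-(η / 2)) + 1) * L ^ A = x ^ c₁ * x ^ (-(η / 2)) * L ^ A + 1 * L ^ A := by
          ring
        linarith only [hid, h3, h4]
      by_cases htK : t ≤ Kmax
      · refine hE4.trans ?_
        have htK' : (t : ℝ) ≤ Kmax := by exact_mod_cast htK
        have hPS0 : 0 ≤ primeTupleSum d x (cornerInd d (η / 2) (c₁ - η / 2)) := by
          unfold primeTupleSum
          exact Finset.sum_nonneg fun q _ => by
            unfold cornerInd; exact Set.indicator_nonneg (fun _ _ => zero_le_one) _
        have hnn : 0 ≤ Hb * (d + 1) * (d + 1 + (Kmax : ℝ)) :=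
          mul_nonneg (mul_nonneg hHb (by positivity)) (by positivity)
        calc Hb * (d + 1) * (d + 1 + t) * primeTupleSum d x (cornerInd d (η / 2) (c₁ - η / 2))
            ≤ Hb * (d + 1) * (d + 1 + Kmax) * (Cc d * (x ^ (c₁ - η / 2) + 1)) := by
              apply mul_le_mul _ hcorner hPS0 hnn
              exact mul_le_mul_of_nonneg_left (by linarith only [htK']) (mul_nonneg hHb (by positivity))
          _ ≤ Hb * (d + 1) * (d + 1 + Kmax) * (Cc d * ((x / m) / L ^ A)) := by
              refine mul_le_mul_of_nonneg_left (mul_le_mul_of_nonneg_left hxdec (hCc0 d)) hnn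
      · -- `h (t + s) = 0`: everything vanishes
        have hz : mainG h t (d + 1) u c₀ c₁ = fun _ => 0 := by
          funext y; unfold mainG; split_ifs
          · exact hvan _ (by omega) _
          · rfl
        have h0 : primeTupleSum (d + 1) x (mainG h t (d + 1) u c₀ c₁) - injSum h x m R (d + 1) = 0 := by
          unfold primeTupleSum injSum
          rw [hz]; simp
        rw [h0, abs_zero]
        exact mul_nonneg (mul_nonneg (mul_nonneg hHb (by positivity)) (by positivity))
          (mul_nonneg (hCc0 d) (div_nonneg (div_nonneg hx0.le hmR.le) hLA.le))
    -- (E3): comparison with the integral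
    have hcmp : |primeTupleSum (d + 1) x (mainG h t (d + 1) u c₀ c₁) -
        primeTupleIntegral (d + 1) x (mainG h t (d + 1) u c₀ c₁)| ≤ CF (d + 1) * Dmax * ((x / m) / L ^ A) := by
      by_cases htK : t + (d + 1) ≤ Kmax
      · have key := abs_primeTupleSum_mainG_sub_integral_le hη hsupp (hF2 (d + 1))
          (le_trans (hXF (d + 1) hs.2) hx) hx1 huabs hc₁1 hρ (hKMk (t + (d + 1))) (hpck (t + (d + 1)))
          (hsumk (t + (d + 1)))
        refine key.trans ?_
        have hsumle : ∑ j, (Kpk (t + (d + 1)) j * (8 * ((d + 1 : ℕ) : ℝ) + 2) + Mpk (t + (d + 1)) j) ≤ Dmax := by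
          refine le_trans (Finset.sum_le_sum fun j _ => ?_) (hDle _ htK)
          have hK := (hKMk (t + (d + 1)) j).1
          have h8 : (8 * ((d + 1 : ℕ) : ℝ) + 2) ≤ 8 * Kmax + 2 := by
            have : ((d + 1 : ℕ) : ℝ) ≤ Kmax := by exact_mod_cast (le_trans (Nat.le_add_left _ _) htK)
            linarith only [this]
          have := mul_le_mul_of_nonneg_left h8 hK
          linarith only [this]
        rw [mul_div_assoc]
        have hx1' : x ^ c₁ / L ^ A ≤ (x / m) / L ^ A := div_le_div_of_nonneg_right hxc₁ hLA.le
        exact mul_le_mul (mul_le_mul_of_nonneg_left hsumle (hCF0 _)) hx1'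
          (div_nonneg (Real.rpow_nonneg hx0.le _) hLA.le) (mul_nonneg (hCF0 _) hDmax0)
      · -- `h (t + s) = 0`
        have hz : mainG h t (d + 1) u c₀ c₁ = fun _ => 0 := by
          funext y; unfold mainG; split_ifs
          · exact hvan _ (by omega) _
          · rfl
        rw [hz]
        unfold primeTupleSum primeTupleIntegral
        simp only [Finset.sum_const_zero, zero_mul, integral_zero, sub_zero, abs_zero]
        exact mul_nonneg (mul_nonneg (hCF0 _) hDmax0) (div_nonneg (div_nonneg hx0.le hmR.le) hLA.le)
    -- combine
    have hsplit : (1 / ((d + 1).factorial : ℝ)) * injSum h x m R (d + 1) -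
        (1 / ((d + 1).factorial : ℝ)) * primeTupleIntegral (d + 1) x (mainG h t (d + 1) u c₀ c₁) =
        (1 / ((d + 1).factorial : ℝ)) *
          ((primeTupleSum (d + 1) x (mainG h t (d + 1) u c₀ c₁) -
              primeTupleIntegral (d + 1) x (mainG h t (d + 1) u c₀ c₁)) -
            (primeTupleSum (d + 1) x (mainG h t (d + 1) u c₀ c₁) - injSum h x m R (d + 1))) := by ring
    rw [hsplit, abs_mul, abs_of_nonneg hfact0]
    calc 1 / ((d + 1).factorial : ℝ) *
          |(primeTupleSum (d + 1) x (mainG h t (d + 1) u c₀ c₁) -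
              primeTupleIntegral (d + 1) x (mainG h t (d + 1) u c₀ c₁)) -
            (primeTupleSum (d + 1) x (mainG h t (d + 1) u c₀ c₁) - injSum h x m R (d + 1))|
        ≤ 1 * (CF (d + 1) * Dmax * ((x / m) / L ^ A) +
            Hb * (d + 1) * (d + 1 + Kmax) * (Cc d * ((x / m) / L ^ A))) := by
          refine mul_le_mul hfact ((abs_sub _ _).trans (add_le_add hcmp hbad)) (abs_nonneg _) zero_le_one
      _ = (CF (d + 1) * Dmax + Hb * ((d + 1 : ℕ) : ℝ) * (((d + 1 : ℕ) : ℝ) + Kmax) * Cc (d + 1 - 1)) *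
            (x / m) / L ^ A := by
          rw [show d + 1 - 1 = d from rfl]; push_cast; ring
  -- summing over `s`
  have hfinal : ∑ s ∈ Finset.Icc 1 Kmax, (1 / (s.factorial : ℝ)) * injSum h x m R s =
      ∑ s ∈ Finset.Icc 1 Kmax, ((1 / (s.factorial : ℝ)) * injSum h x m R s -
        (1 / (s.factorial : ℝ)) * primeTupleIntegral s x (mainG h t s u c₀ c₁)) := by
    rw [Finset.sum_sub_distrib, hmain, sub_zero]
  rw [hfinal]
  calc |∑ s ∈ Finset.Icc 1 Kmax, ((1 / (s.factorial : ℝ)) * injSum h x m R s -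
        (1 / (s.factorial : ℝ)) * primeTupleIntegral s x (mainG h t s u c₀ c₁))|
      ≤ ∑ s ∈ Finset.Icc 1 Kmax, |(1 / (s.factorial : ℝ)) * injSum h x m R s -
        (1 / (s.factorial : ℝ)) * primeTupleIntegral s x (mainG h t s u c₀ c₁)| := Finset.abs_sum_le_sum_abs _ _
    _ ≤ ∑ s ∈ Finset.Icc 1 Kmax, (CF s * Dmax + Hb * s * (s + Kmax) * Cc (s - 1)) * (x / m) / L ^ A :=
        Finset.sum_le_sum hper
    _ = C * (x / m) / L ^ A := by rw [hCdef, Finset.sum_mul, Finset.sum_div]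

end Literature.NumberTheory.Sieve.FordMaynard
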